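import Literature.MeasureTheory.Integral.ShellReduction
import Literature.MeasureTheory.Group.LocalFieldLinearJacobian
import Literature.NumberTheory.Automorphic.LocalFieldHaarBalls
import HarnessLib

/-!
# Homogeneous vertex integrability: a homogeneous function integrable off the vertex is integrable at the vertex

Topic `Literature/MeasureTheory/Integral` (on ★ `ShellReduction`, the geometric-series half, and ★ `Group/LocalFieldLinearJacobian`,
the Jacobian of a dilation); namespace `Literature.MeasureTheory.Integral`.  THEOREMS ONLY (no definition ∕ instance ∕ notation ∕
named fact ∕ `sorry`).  Cell `pub/hodgecm-mathlib`, crux H413 = `stmt-HodgeConjecture-24833` (lane `--supports`, count-neutral):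
brick **(D3v) «VERTEX ENGINE»** of the ROAD «HC-D» (holder F0P2-p01 (g23)), seat LH10-p01 (g7), 2026-09-02.  CONSUMERS: D3b
(`|Q|^{−1∕2}` on `F³`, `T = ϖ • id`, `c = q`), D3c (plane cusp, weights `(2,3)`), D5(iii) (Slodowy slice, weights `(2,3,3,4)`),
D5(iv) (`ϖ • id` on `𝔤′`).  HONEST LABEL: HC_CM is proved only modulo the 7 printed citations (2 remaining: hLiu418 =
`stmt-HodgeConjecture-24832`, h413 = `stmt-HodgeConjecture-24833`) until rung 0 closes; this file closes no organ.

§1 ABSTRACT ENGINE (`setLIntegral_lt_top_of_contraction`, `forall_exists_nhds_…_of_contraction`): `T : X → X` maps measurable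
sets to measurable sets, `W₀` is compact measurable and `T`-stable, `T '' W₀` is a neighbourhood of the VERTEX `x₀`, the `f`-mass
of measurable subsets of `W₀` contracts by `θ < 1`, the core `⋂ₖ T^[k] '' W₀` has no `f`-mass, and every `y ≠ x₀` has a
neighbourhood of finite `f`-integral ⇒ `∫⁻_{W₀} f < ∞` (the first shell lies in the compact `W₀ ∖ interior (T '' W₀)`, which
misses `x₀`: finitely many neighbourhoods cover it; ★ `shell_reduction_le_of_image` does the rest), hence local integrability
everywhere.  §2 JACOBIAN FORM (`…_of_measure_image_le`): `T` a homeomorphism with `μ (T '' s) ≤ d · μ s`, `f (T v) ≤ c · f v` off the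
vertex, `d · c < 1` — the coordinate-free form.  §3–§4 LOCAL-FIELD HEADS: `F` non-archimedean local (`q = #𝓀_F`), scalars
`‖aᵢ‖_F = (q⁻¹)^{kᵢ}`, `kᵢ ≥ 1` (e.g. `aᵢ = ϖ^{wᵢ}`), the dilation `x ↦ (aᵢ xᵢ)ᵢ` of `ι → F` (resp. a map `T` of a trivialised
carrier `eV : V ≃L[F] (ι → F)` with `eV (T v) i = aᵢ · eV v i`), `μ` any additive Haar measure, `f (T v) = c · f v` for `v ≠ 0`,
`c < q^{Σ k}` (= `c · mod(T) < 1`): finiteness near every `y ≠ 0` ⇒ near every point (`…_of_homogeneous_pi`, `…_of_homogeneous`);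
`addHaar_image_dilation` is the Jacobian `μ (D S) = q^{−Σ k} μ S`.  The case `ι = pt`, `a = ϖ`, `f = ‖·‖^{σ−1}` is Tate's shell
computation of `∫_{𝒪} ‖x‖^{σ−1} dx`; no measurability of `f` is used (changes of variables go through measurable equivalences).

## References
* [Tate1950] J. Tate, *Fourier analysis in number fields and Hecke's zeta-functions* (1950), §2.4 (local zeta integral, shell by shell).
* [DeitmarEchterhoff2014] A. Deitmar, S. Echterhoff, *Principles of Harmonic Analysis* (2014), §1.5 (modulus of an automorphism).
-/

set_option autoImplicit false

noncomputable section

open MeasureTheory MeasureTheory.Measure Set Filter Topology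
open scoped ENNReal NNReal Pointwise
open Literature.NumberTheory.GaloisRepresentations.IsNonarchimedeanLocalField
open Literature.NumberTheory.Automorphic Literature.NumberTheory.Automorphic.LocalFieldHaar

namespace Literature.MeasureTheory.Integral

/-! ## §1 The abstract vertex engine -/

section Abstract
variable {X : Type*} [TopologicalSpace X] [MeasurableSpace X]

/-- **Vertex engine (abstract).**  `T : X → X` maps measurable sets to measurable sets; `W₀` is compact, measurable and
`T`-stable; the first contraction `T '' W₀` is a neighbourhood of the vertex `x₀`; the `f`-mass of every measurable
`A ⊆ W₀` contracts by `θ < 1` under `T`; the core `⋂ₖ T^[k] '' W₀` has no `f`-mass; and every `y ∈ W₀`, `y ≠ x₀`, has a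
neighbourhood of finite `f`-integral.  Then `∫⁻ x in W₀, f x ∂μ < ∞`: the first shell `W₀ ∖ T '' W₀` is covered by
finitely many of those neighbourhoods (it lies in the compact `W₀ ∖ interior (T '' W₀)`, which misses `x₀`), and
★ `shell_reduction_le_of_image` gives `∫⁻_{W₀} f ≤ (1 − θ)⁻¹ ∫⁻_{W₀ ∖ T '' W₀} f`.
[cite: Tate1950, §2.4 (shell-by-shell convergence; abstract form of the argument)] -/
theorem setLIntegral_lt_top_of_contraction (μ : Measure X) (f : X → ℝ≥0∞) (T : X → X)
    (hTm : ∀ A : Set X, MeasurableSet A → MeasurableSet (T '' A))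
    (W₀ : Set X) (hW₀c : IsCompact W₀) (hW₀m : MeasurableSet W₀) (hT : T '' W₀ ⊆ W₀)
    (x₀ : X) (hx₀ : T '' W₀ ∈ 𝓝 x₀) (θ : ℝ≥0∞) (hθ : θ < 1)
    (hcontract : ∀ A ⊆ W₀, MeasurableSet A → ∫⁻ x in T '' A, f x ∂μ ≤ θ * ∫⁻ x in A, f x ∂μ)
    (hcore : ∫⁻ x in ⋂ k, T^[k] '' W₀, f x ∂μ = 0)
    (hoff : ∀ y ∈ W₀, y ≠ x₀ → ∃ U ∈ 𝓝 y, ∫⁻ x in U, f x ∂μ < ∞) :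
    ∫⁻ x in W₀, f x ∂μ < ∞ := by
  have hSc : IsCompact (W₀ \ interior (T '' W₀)) := hW₀c.diff isOpen_interior
  have hSx : ∀ y ∈ W₀ \ interior (T '' W₀), y ≠ x₀ := by
    rintro y ⟨-, hy⟩ rfl; exact hy (mem_interior_iff_mem_nhds.2 hx₀)
  choose! U hU hUf using hoff
  obtain ⟨t, htS, htcov⟩ := hSc.elim_nhds_subcover U (fun y hy => hU y hy.1 (hSx y hy))
  have hfin : ∫⁻ x in ⋃ y ∈ t, U y, f x ∂μ < ∞ := by
    have e : (⋃ y ∈ t, U y) = ⋃ y : (t : Set X), U y := by rw [← Finset.set_biUnion_coe, biUnion_eq_iUnion]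
    rw [e]
    refine (lintegral_iUnion_le _ _).trans_lt ?_
    rw [tsum_fintype]
    exact ENNReal.sum_lt_top.2 fun y _ => hUf y (htS _ y.2).1 (hSx _ (htS _ y.2))
  have hshell : ∫⁻ x in W₀ \ T '' W₀, f x ∂μ < ∞ :=
    (lintegral_mono_set ((sdiff_le_sdiff_left interior_subset).trans htcov)).trans_lt hfin
  refine (shell_reduction_le_of_image μ f T hTm W₀ hW₀m hT θ hcontract hcore).trans_lt ?_
  exact ENNReal.mul_lt_top (ENNReal.inv_lt_top.2 (tsub_pos_of_lt hθ)) hshell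

/-- **Vertex engine, local-integrability form.**  In the setting of `setLIntegral_lt_top_of_contraction`, if moreover `W₀`
is a neighbourhood of the vertex `x₀` and EVERY `y ≠ x₀` has a neighbourhood of finite `f`-integral, then so does every point
of `X` (the vertex included: take `W₀`). [cite: Tate1950, §2.4 (shell-by-shell convergence; abstract form of the argument)] -/
theorem forall_exists_nhds_setLIntegral_lt_top_of_contraction (μ : Measure X) (f : X → ℝ≥0∞) (T : X → X)
    (hTm : ∀ A : Set X, MeasurableSet A → MeasurableSet (T '' A))
    (W₀ : Set X) (hW₀c : IsCompact W₀) (hW₀m : MeasurableSet W₀) (hT : T '' W₀ ⊆ W₀)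
    (x₀ : X) (hW₀ : W₀ ∈ 𝓝 x₀) (hx₀ : T '' W₀ ∈ 𝓝 x₀) (θ : ℝ≥0∞) (hθ : θ < 1)
    (hcontract : ∀ A ⊆ W₀, MeasurableSet A → ∫⁻ x in T '' A, f x ∂μ ≤ θ * ∫⁻ x in A, f x ∂μ)
    (hcore : ∫⁻ x in ⋂ k, T^[k] '' W₀, f x ∂μ = 0)
    (hoff : ∀ y, y ≠ x₀ → ∃ U ∈ 𝓝 y, ∫⁻ x in U, f x ∂μ < ∞) :
    ∀ y, ∃ U ∈ 𝓝 y, ∫⁻ x in U, f x ∂μ < ∞ := by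
  intro y
  by_cases hy : y = x₀
  · subst hy
    exact ⟨W₀, hW₀, setLIntegral_lt_top_of_contraction μ f T hTm W₀ hW₀c hW₀m hT y hx₀ θ hθ hcontract hcore
      fun z _ hz => hoff z hz⟩
  · exact hoff y hy

end Abstract

/-! ## §2 The engine for a bi-continuous self-map with a Jacobian bound (coordinate-free consumers) -/

section Jacobian
variable {V : Type*} [TopologicalSpace V] [MeasurableSpace V] [BorelSpace V]

/-- **Vertex engine, Jacobian form.**  `T : V ≃ₜ V` a homeomorphism of a topological space with Borel measure `μ`,
`x₀` a point with `μ {x₀} = 0`, `W₀` a compact measurable neighbourhood of `x₀` with `T '' W₀ ⊆ W₀`, `T '' W₀ ∈ 𝓝 x₀` and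
`⋂ₖ T^[k] '' W₀ ⊆ {x₀}` (a CONTRACTION onto the vertex), a JACOBIAN BOUND `μ (T '' s) ≤ d · μ s` on measurable sets, and
`f ≥ 0` SUB-HOMOGENEOUS: `f (T v) ≤ c · f v` for `v ≠ x₀`, with `d · c < 1`.  If every `y ≠ x₀` has a neighbourhood of
finite `f`-integral, so does every point.  (No group structure, no Haar measure, no measurability of `f`: the form a
consumer with only an index computation `μ (T W) = d · μ W` can use.)
[cite: Tate1950, §2.4 (local zeta integral, shell by shell; abstract form of the argument)] -/
theorem forall_exists_nhds_setLIntegral_lt_top_of_measure_image_le (μ : Measure V) (T : V ≃ₜ V) (x₀ : V)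
    (h0 : μ {x₀} = 0) (W₀ : Set V) (hW₀c : IsCompact W₀) (hW₀m : MeasurableSet W₀) (hT : T '' W₀ ⊆ W₀)
    (hW₀ : W₀ ∈ 𝓝 x₀) (hx₀ : T '' W₀ ∈ 𝓝 x₀) (hcore : (⋂ k, T^[k] '' W₀) ⊆ {x₀})
    (d : ℝ≥0∞) (hJ : ∀ s, MeasurableSet s → μ (T '' s) ≤ d * μ s)
    (f : V → ℝ≥0∞) (c : ℝ≥0∞) (hhom : ∀ v, v ≠ x₀ → f (T v) ≤ c * f v) (hc : d * c < 1)
    (hoff : ∀ y, y ≠ x₀ → ∃ U ∈ 𝓝 y, ∫⁻ x in U, f x ∂μ < ∞) :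
    ∀ y, ∃ U ∈ 𝓝 y, ∫⁻ x in U, f x ∂μ < ∞ := by
  let Te : V ≃ᵐ V := T.toMeasurableEquiv
  have hTe : ∀ v, Te v = T v := fun _ => rfl
  have himg : ∀ s : Set V, T '' s = Te.symm ⁻¹' s := fun s => by
    ext y
    simp only [mem_preimage, mem_image]
    constructor
    · rintro ⟨x, hx, rfl⟩; rw [← hTe, MeasurableEquiv.symm_apply_apply]; exact hx
    · intro hy; exact ⟨Te.symm y, hy, by rw [← hTe, MeasurableEquiv.apply_symm_apply]⟩
  have hmap : μ.map Te.symm ≤ d • μ := Measure.le_iff.2 fun s hs => by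
    rw [MeasurableEquiv.map_apply, Measure.smul_apply, smul_eq_mul, ← himg]
    exact hJ s hs
  have hcontract : ∀ A ⊆ W₀, MeasurableSet A → ∫⁻ x in T '' A, f x ∂μ ≤ (d * c) * ∫⁻ x in A, f x ∂μ := by
    intro A _ hA
    have step : ∫⁻ x in T '' A, f x ∂μ ≤ d * ∫⁻ x in A, f (T x) ∂μ := by
      calc ∫⁻ x in T '' A, f x ∂μ = ∫⁻ x in Te.symm ⁻¹' A, f (Te (Te.symm x)) ∂μ := by
            rw [himg]; simp only [MeasurableEquiv.apply_symm_apply]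
        _ = ∫⁻ y in A, f (Te y) ∂(μ.map Te.symm) := by rw [MeasurableEquiv.restrict_map, lintegral_map_equiv]
        _ ≤ ∫⁻ y in A, f (Te y) ∂(d • μ) := lintegral_mono' (Measure.restrict_mono subset_rfl hmap) le_rfl
        _ = d * ∫⁻ x in A, f (T x) ∂μ := by rw [Measure.restrict_smul, lintegral_smul_measure, smul_eq_mul]; rfl
    by_cases hct : c = ∞
    · have hd : d = 0 := by
        by_contra hd
        rw [hct, ENNReal.mul_top hd] at hc
        exact not_top_lt hc
      rw [hd, zero_mul] at step
      exact (nonpos_iff_eq_zero.1 step).le.trans bot_le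
    have hae : (fun x => f (T x)) ≤ᵐ[μ.restrict A] fun x => c * f x := by
      have hA0 : (μ.restrict A) {x₀} = 0 :=
        le_antisymm ((Measure.le_iff'.1 Measure.restrict_le_self _).trans h0.le) bot_le
      filter_upwards [compl_mem_ae_iff.2 hA0] with x hx
      exact hhom x hx
    calc ∫⁻ x in T '' A, f x ∂μ ≤ d * ∫⁻ x in A, f (T x) ∂μ := step
      _ ≤ d * ∫⁻ x in A, c * f x ∂μ := by gcongr d * ?_; exact lintegral_mono_ae hae
      _ = (d * c) * ∫⁻ x in A, f x ∂μ := by rw [lintegral_const_mul' c _ hct, mul_assoc]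
  have hcore' : ∫⁻ x in ⋂ k, (T : V → V)^[k] '' W₀, f x ∂μ = 0 :=
    setLIntegral_measure_zero _ _ (measure_mono_null hcore h0)
  have hTm : ∀ A : Set V, MeasurableSet A → MeasurableSet (T '' A) := fun A hA => by
    rw [himg]; exact Te.symm.measurable hA
  exact forall_exists_nhds_setLIntegral_lt_top_of_contraction μ f T hTm W₀ hW₀c hW₀m hT x₀ hW₀ hx₀ (d * c) hc
    hcontract hcore' hoff

end Jacobian

/-! ## §3 Homogeneous functions on a coordinate space over a non-archimedean local field -/

section LocalField
variable {F : Type*} [Field F] [ValuativeRel F] [TopologicalSpace F] [IsNonarchimedeanLocalField F]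
  {ι : Type*} [Fintype ι]

/-- The dilation `x ↦ (a_i x_i)_i` (`a_i ≠ 0`) is a continuous linear automorphism of `ι → F`. [folklore] -/
private theorem exists_dilation_continuousLinearEquiv (a : ι → F) (ha0 : ∀ i, a i ≠ 0) :
    ∃ D : (ι → F) ≃L[F] (ι → F), ∀ x i, D x i = a i * x i := by
  let L : (ι → F) ≃ₗ[F] (ι → F) :=
    LinearEquiv.piCongrRight fun i => LinearEquiv.smulOfUnit (Units.mk0 (a i) (ha0 i))
  refine ⟨ContinuousLinearEquiv.mk L L.toLinearMap.continuous_on_pi L.symm.toLinearMap.continuous_on_pi,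
    fun x i => ?_⟩
  change L x i = _; simp [L, LinearEquiv.smulOfUnit]

omit [Fintype ι] in
/-- `a_i ≠ 0` when `‖a_i‖_F = (q⁻¹)^{k_i}`. [folklore] -/
private theorem ne_zero_of_normAbs_eq (a : ι → F) (k : ι → ℕ)
    (ha : ∀ i, normAbs F (a i) = ((residueFieldCard F : ℝ≥0)⁻¹) ^ k i) (i : ι) : a i ≠ 0 := by
  intro h; have h1 := ha i; rw [h, map_zero] at h1; exact (pow_pos inv_residueFieldCard_pos (k i)).ne h1

omit [Fintype ι] in
/-- **The dilation maps boxes to boxes**: `D (∏ᵢ 𝔭^{nᵢ}) = ∏ᵢ 𝔭^{nᵢ + kᵢ}` for `‖aᵢ‖ = (q⁻¹)^{kᵢ}`. [folklore] -/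
private theorem image_dilation_pi (a : ι → F) (k : ι → ℕ)
    (ha : ∀ i, normAbs F (a i) = ((residueFieldCard F : ℝ≥0)⁻¹) ^ k i)
    (D : (ι → F) ≃L[F] (ι → F)) (hD : ∀ x i, D x i = a i * x i) (n : ι → ℤ) :
    D '' Set.pi univ (fun i => primePowBall F (n i)) = Set.pi univ (fun i => primePowBall F (n i + k i)) := by
  have ha' : ∀ i, normAbs F (a i) = ((residueFieldCard F : ℝ≥0)⁻¹) ^ (k i : ℤ) := fun i => by rw [zpow_natCast]; exact ha i
  have ha0 := ne_zero_of_normAbs_eq a k ha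
  ext y
  simp only [mem_image, mem_univ_pi]
  constructor
  · rintro ⟨x, hx, rfl⟩ i
    rw [hD, mul_mem_primePowBall_iff (ha' i), add_sub_cancel_right]; exact hx i
  · intro hy
    refine ⟨fun i => (a i)⁻¹ * y i, fun i => ?_, ?_⟩
    · have h := (mul_mem_primePowBall_iff (ha' i) (m := n i + k i) (x := (a i)⁻¹ * y i)).1
      rw [mul_inv_cancel_left₀ (ha0 i), add_sub_cancel_right] at h
      exact h (hy i)
    · funext i; rw [hD, mul_inv_cancel_left₀ (ha0 i)]

omit [Fintype ι] in
/-- Iterating the dilation: `D^[j] (∏ᵢ 𝔭^{nᵢ}) = ∏ᵢ 𝔭^{nᵢ + j kᵢ}`. [folklore] -/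
private theorem image_iterate_dilation_pi (a : ι → F) (k : ι → ℕ)
    (ha : ∀ i, normAbs F (a i) = ((residueFieldCard F : ℝ≥0)⁻¹) ^ k i)
    (D : (ι → F) ≃L[F] (ι → F)) (hD : ∀ x i, D x i = a i * x i) (n : ι → ℤ) (j : ℕ) :
    (D : (ι → F) → ι → F)^[j] '' Set.pi univ (fun i => primePowBall F (n i)) =
      Set.pi univ (fun i => primePowBall F (n i + j * k i)) := by
  induction j with
  | zero => simp
  | succ j ih =>
    rw [Function.iterate_succ', image_comp, ih, image_dilation_pi a k ha D hD]
    congr 1; funext i; congr 1; push_cast; ring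

omit [Fintype ι] in
/-- The core of the contraction is the vertex: `⋂ⱼ D^[j] (∏ᵢ 𝒪) ⊆ {0}` when all `kᵢ ≥ 1`. [folklore] -/
private theorem iInter_image_iterate_dilation_subset (a : ι → F) (k : ι → ℕ) (hk : ∀ i, 1 ≤ k i)
    (ha : ∀ i, normAbs F (a i) = ((residueFieldCard F : ℝ≥0)⁻¹) ^ k i)
    (D : (ι → F) ≃L[F] (ι → F)) (hD : ∀ x i, D x i = a i * x i) :
    (⋂ j : ℕ, (D : (ι → F) → ι → F)^[j] '' Set.pi univ (fun _ => primePowBall F 0)) ⊆ {0} := by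
  intro x hx
  rw [mem_singleton_iff]; funext i; rw [Pi.zero_apply]
  by_contra hxi
  have hpos : 0 < normAbs F (x i) := pos_iff_ne_zero.2 fun h => hxi ((map_eq_zero (normAbs F)).1 h)
  obtain ⟨j, hj⟩ := exists_pow_lt_of_lt_one hpos (inv_residueFieldCard_lt_one (F := F))
  have hxj : x ∈ (D : (ι → F) → ι → F)^[j] '' Set.pi univ (fun _ => primePowBall F 0) := mem_iInter.1 hx j
  rw [image_iterate_dilation_pi a k ha D hD (fun _ => 0) j, mem_univ_pi] at hxj
  have h1 : x i ∈ primePowBall F j :=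
    primePowBall_antitone (by have h1k : (1 : ℤ) ≤ k i := by exact_mod_cast hk i
                              nlinarith) (hxj i)
  rw [mem_primePowBall_iff, zpow_natCast] at h1
  exact (lt_irrefl _) (h1.trans_lt hj)

variable [MeasurableSpace F] [BorelSpace F]

omit [Fintype ι] in
/-- **Modulus of a scalar**: `distribHaarChar F a = ‖a‖_F` for `‖a‖_F = (q⁻¹)^k` (★ `addHaar_smul_set` on `𝒪 = 𝔭⁰`).
[folklore] -/
private theorem distribHaarChar_mk0_eq {a : F} {k : ℕ} (ha : normAbs F a = ((residueFieldCard F : ℝ≥0)⁻¹) ^ k)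
    (ha0 : a ≠ 0) : distribHaarChar F (Units.mk0 a ha0) = ((residueFieldCard F : ℝ≥0)⁻¹) ^ k := by
  haveI := regular_of_isAddHaarMeasure (addHaar : Measure F)
  refine distribHaarChar_eq_of_measure_smul_eq_mul (μ := (addHaar : Measure F)) (s := primePowBall F 0)
    (addHaar_primePowBall_pos addHaar 0).ne' (measure_primePowBall_lt_top addHaar 0).ne ?_
  change addHaar (a • primePowBall F 0) = _; rw [addHaar_smul_set addHaar ha0, ha]

/-- **Jacobian of a dilation**: `μ (D S) = q^{−Σ k} · μ S` for EVERY set `S`, every additive Haar measure `μ` on `ι → F`,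
and the dilation `D x = (aᵢ xᵢ)ᵢ` with `‖aᵢ‖_F = (q⁻¹)^{kᵢ}` (★ `LocalFieldLinearJacobian`: the Haar character of a
diagonal map is the product of the moduli of its entries).
[cite: DeitmarEchterhoff2014, §1.5 (modulus of an automorphism; diagonal case)] -/
theorem addHaar_image_dilation (μ : Measure (ι → F)) [μ.IsAddHaarMeasure] (a : ι → F) (k : ι → ℕ)
    (ha : ∀ i, normAbs F (a i) = ((residueFieldCard F : ℝ≥0)⁻¹) ^ k i)
    (D : (ι → F) ≃L[F] (ι → F)) (hD : ∀ x i, D x i = a i * x i) (s : Set (ι → F)) :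
    μ (D '' s) = ((((residueFieldCard F : ℝ≥0)⁻¹) ^ (∑ i, k i) : ℝ≥0) : ℝ≥0∞) * μ s := by
  have ha0 := ne_zero_of_normAbs_eq a k ha
  haveI := pseudoMetrizableSpace_localField F
  haveI := secondCountableTopology_localField F
  haveI : μ.Regular := inferInstance
  have h1 := Literature.MeasureTheory.Group.measure_image_eq_addEquivAddHaarChar_mul μ D.toContinuousAddEquiv s
  rw [show ((D.toContinuousAddEquiv : (ι → F) ≃ₜ+ (ι → F)) : (ι → F) → ι → F) = D from rfl] at h1
  rw [h1]
  congr 2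
  have h := Literature.MeasureTheory.Group.addEquivAddHaarChar_eq_prod_of_apply_eq_mul D
    (fun i => Units.mk0 (a i) (ha0 i)) (fun x i => by rw [Units.val_mk0]; exact hD x i)
  rw [h, ← Finset.prod_pow_eq_pow_sum]
  exact Finset.prod_congr rfl fun i _ => distribHaarChar_mk0_eq (ha i) (ha0 i)

variable [Nonempty ι]

/-- **Vertex engine on `ι → F`.**  `F` a non-archimedean local field (`q = #𝓀_F`), scalars `aᵢ` with
`‖aᵢ‖_F = (q⁻¹)^{kᵢ}`, `kᵢ ≥ 1` (e.g. `aᵢ = ϖ^{wᵢ}` for a uniformiser `ϖ`), `μ` ANY additive Haar measure on `ι → F` (`ι`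
finite, non-empty), and `f ≥ 0` (SUB-)HOMOGENEOUS under the dilation `D x = (aᵢ xᵢ)ᵢ`: `f (D x) ≤ c · f x` for `x ≠ 0`, with
`c < q^{Σ k}` (i.e. `c · mod(D) < 1`, `mod(D) = q^{−Σ k}`).  If every `y ≠ 0` has a neighbourhood of finite `f`-integral,
then EVERY point has one, the vertex `0` included (no measurability of `f` needed).  The case `ι = pt`, `a = ϖ`,
`f = ‖·‖^{σ−1}`, `c = q^{1−σ}` is Tate's convergence of `∫_{𝒪} ‖x‖^{σ−1} dx` for `σ > 0`.
[cite: Tate1950, §2.4 (local zeta integral, shell by shell; weighted-homogeneous form)] -/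
theorem forall_exists_nhds_setLIntegral_lt_top_of_homogeneous_pi (μ : Measure (ι → F)) [μ.IsAddHaarMeasure]
    (a : ι → F) (k : ι → ℕ) (hk : ∀ i, 1 ≤ k i) (ha : ∀ i, normAbs F (a i) = ((residueFieldCard F : ℝ≥0)⁻¹) ^ k i)
    (f : (ι → F) → ℝ≥0∞) (c : ℝ≥0∞) (hhom : ∀ x, x ≠ 0 → f (fun i => a i * x i) ≤ c * f x)
    (hc : c < (residueFieldCard F : ℝ≥0∞) ^ (∑ i, k i))
    (hoff : ∀ y, y ≠ 0 → ∃ U ∈ 𝓝 y, ∫⁻ x in U, f x ∂μ < ∞) :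
    ∀ y, ∃ U ∈ 𝓝 y, ∫⁻ x in U, f x ∂μ < ∞ := by
  have ha0 := ne_zero_of_normAbs_eq a k ha
  haveI := secondCountableTopology_localField F
  obtain ⟨D, hD⟩ := exists_dilation_continuousLinearEquiv (F := F) a ha0
  have hDfun : ∀ x, D x = fun i => a i * x i := fun x => funext (hD x)
  -- the Jacobian constant and the contraction ratio
  set δ : ℝ≥0∞ := ((((residueFieldCard F : ℝ≥0)⁻¹) ^ (∑ i, k i) : ℝ≥0) : ℝ≥0∞) with hδ
  have hq0 : (residueFieldCard F : ℝ≥0∞) ≠ 0 := by exact_mod_cast (residueFieldCard_ne_zero F)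
  have hqS0 : (residueFieldCard F : ℝ≥0∞) ^ (∑ i, k i) ≠ 0 := pow_ne_zero _ hq0
  have hqStop : (residueFieldCard F : ℝ≥0∞) ^ (∑ i, k i) ≠ ∞ := ENNReal.pow_ne_top (ENNReal.natCast_ne_top _)
  have hδ' : δ = ((residueFieldCard F : ℝ≥0∞) ^ (∑ i, k i))⁻¹ := by
    rw [hδ, ENNReal.coe_pow, ENNReal.coe_inv (by exact_mod_cast (residueFieldCard_ne_zero F)), ENNReal.coe_natCast,
      ENNReal.inv_pow]
  have hθ : δ * c < 1 := by
    rw [hδ']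
    calc ((residueFieldCard F : ℝ≥0∞) ^ ∑ i, k i)⁻¹ * c
        < ((residueFieldCard F : ℝ≥0∞) ^ ∑ i, k i)⁻¹ * (residueFieldCard F : ℝ≥0∞) ^ ∑ i, k i :=
          ENNReal.mul_lt_mul_right (ENNReal.inv_ne_zero.2 hqStop) (ENNReal.inv_ne_top.2 hqS0) hc
      _ = 1 := ENNReal.inv_mul_cancel hqS0 hqStop
  -- the box `W₀ = ∏ 𝒪` and its properties
  set W₀ : Set (ι → F) := Set.pi univ (fun _ => primePowBall F 0) with hW₀
  have hW₀c : IsCompact W₀ := isCompact_univ_pi fun _ => isCompact_primePowBall 0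
  have hW₀o : IsOpen W₀ := isOpen_set_pi finite_univ fun _ _ => isOpen_primePowBall 0
  have h0W₀ : (0 : ι → F) ∈ W₀ := fun i _ => zero_mem_primePowBall 0
  have hDW₀ : D '' W₀ = Set.pi univ (fun i => primePowBall F (0 + k i)) := image_dilation_pi a k ha D hD _
  have hT : D '' W₀ ⊆ W₀ := by
    rw [hDW₀]
    exact pi_mono fun i _ => primePowBall_antitone (by omega)
  have hx₀ : D '' W₀ ∈ 𝓝 (0 : ι → F) := by
    rw [hDW₀]
    exact (isOpen_set_pi finite_univ fun _ _ => isOpen_primePowBall _).mem_nhds fun i _ => zero_mem_primePowBall _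
  -- `μ {0} = 0`: the vertex is `D`-fixed and `D` strictly contracts Haar measure
  have hδ1 : δ < 1 := by
    rw [hδ']
    refine ENNReal.inv_lt_one.2 (one_lt_pow₀ ?_ ?_)
    · exact_mod_cast one_lt_residueFieldCard F
    · exact (Finset.sum_pos (fun i _ => hk i) Finset.univ_nonempty).ne'
  have hμ0 : μ {0} = 0 := by
    have h := addHaar_image_dilation μ a k ha D hD {0}
    rw [image_singleton, map_zero] at h
    have hfin : μ {0} < ∞ := (measure_mono (singleton_subset_iff.2 h0W₀)).trans_lt hW₀c.measure_lt_top
    by_contra hne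
    have h2 : δ * μ {0} < 1 * μ {0} := ENNReal.mul_lt_mul_left hne hfin.ne hδ1
    rw [one_mul, ← h] at h2
    exact lt_irrefl _ h2
  refine forall_exists_nhds_setLIntegral_lt_top_of_measure_image_le μ D.toHomeomorph 0 hμ0 W₀ hW₀c
    hW₀o.measurableSet hT (hW₀o.mem_nhds h0W₀) hx₀ (iInter_image_iterate_dilation_subset a k hk ha D hD) δ
    (fun s _ => (addHaar_image_dilation μ a k ha D hD s).le) f c (fun x hx => ?_) hθ hoff
  change f (D x) ≤ c * f x
  rw [hDfun]; exact hhom x hx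

end LocalField

/-! ## §4 The same on a trivialised carrier (`eV : V ≃L[F] (ι → F)`, the currency of ★ `LocalFieldLinearJacobian` §4) -/

section Trivialised
variable {F : Type*} [Field F] [ValuativeRel F] [TopologicalSpace F] [IsNonarchimedeanLocalField F]
  [MeasurableSpace F] [BorelSpace F] {ι : Type*} [Fintype ι] [Nonempty ι]
  {V : Type*} [AddCommGroup V] [Module F V] [TopologicalSpace V] [IsTopologicalAddGroup V]
  [MeasurableSpace V] [BorelSpace V]

/-- Set integrals along a measurable equivalence: `∫⁻_{S} g ∘ e⁻¹ d(e_* μ) = ∫⁻_{e⁻¹ S} g dμ` (no measurability of `g`).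
[folklore] -/
private theorem setLIntegral_map_equiv_comp_symm {α β : Type*} [MeasurableSpace α] [MeasurableSpace β]
    (μ : Measure α) (e : α ≃ᵐ β) (g : α → ℝ≥0∞) (S : Set β) :
    ∫⁻ x in S, g (e.symm x) ∂(μ.map e) = ∫⁻ v in e ⁻¹' S, g v ∂μ := by
  rw [MeasurableEquiv.restrict_map, lintegral_map_equiv]
  simp only [MeasurableEquiv.symm_apply_apply]

/-- **Vertex engine on a trivialised carrier.**  `V` a topological `F`-module with Borel σ-algebra and additive Haar
measure `μ`, `eV : V ≃L[F] (ι → F)` a continuous linear trivialisation (`ι` finite non-empty), `T : V → V` ANY map with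
coordinates `eV (T v) i = aᵢ · eV v i`, `‖aᵢ‖_F = (q⁻¹)^{kᵢ}`, `kᵢ ≥ 1` (e.g. `T = (ϖ • ·)`, `a = ϖ`, `k = 1`), and `f ≥ 0`
with `f (T v) ≤ c · f v` for `v ≠ 0`, `c < q^{Σ k}`.  If every `y ≠ 0` has a neighbourhood of finite `f`-integral, so does
every point of `V`.  (Transport of `…_of_homogeneous_pi` along `eV`.)
[cite: Tate1950, §2.4 (local zeta integral, shell by shell; weighted-homogeneous form)] -/
theorem forall_exists_nhds_setLIntegral_lt_top_of_homogeneous (μ : Measure V) [μ.IsAddHaarMeasure]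
    (eV : V ≃L[F] (ι → F)) (T : V → V) (a : ι → F) (k : ι → ℕ) (hk : ∀ i, 1 ≤ k i)
    (ha : ∀ i, normAbs F (a i) = ((residueFieldCard F : ℝ≥0)⁻¹) ^ k i) (hT : ∀ v i, eV (T v) i = a i * eV v i)
    (f : V → ℝ≥0∞) (c : ℝ≥0∞) (hhom : ∀ v, v ≠ 0 → f (T v) ≤ c * f v)
    (hc : c < (residueFieldCard F : ℝ≥0∞) ^ (∑ i, k i))
    (hoff : ∀ y, y ≠ 0 → ∃ U ∈ 𝓝 y, ∫⁻ x in U, f x ∂μ < ∞) :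
    ∀ y, ∃ U ∈ 𝓝 y, ∫⁻ x in U, f x ∂μ < ∞ := by
  haveI := secondCountableTopology_localField F
  let e : V ≃ᵐ (ι → F) := eV.toHomeomorph.toMeasurableEquiv
  haveI hHaar : (μ.map e).IsAddHaarMeasure := eV.isAddHaarMeasure_map μ
  let g : (ι → F) → ℝ≥0∞ := fun x => f (eV.symm x)
  -- `eV⁻¹` intertwines the model dilation with `T`
  have hTe : ∀ x : ι → F, eV.symm (fun i => a i * x i) = T (eV.symm x) := by
    intro x; apply eV.injective; rw [ContinuousLinearEquiv.apply_symm_apply]; funext i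
    rw [hT, ContinuousLinearEquiv.apply_symm_apply]
  have hne : ∀ x : ι → F, x ≠ 0 → eV.symm x ≠ 0 := fun x hx h0 => hx ((map_eq_zero_iff _ eV.symm.injective).1 h0)
  have hhom' : ∀ x : ι → F, x ≠ 0 → g (fun i => a i * x i) ≤ c * g x := by
    intro x hx
    change f (eV.symm _) ≤ c * f (eV.symm x)
    rw [hTe]
    exact hhom _ (hne x hx)
  -- set integrals transport along `e`
  have htrans : ∀ S : Set (ι → F), ∫⁻ x in S, g x ∂(μ.map e) = ∫⁻ v in eV ⁻¹' S, f v ∂μ := fun S =>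
    setLIntegral_map_equiv_comp_symm μ e f S
  have hoff' : ∀ y : ι → F, y ≠ 0 → ∃ U ∈ 𝓝 y, ∫⁻ x in U, g x ∂(μ.map e) < ∞ := by
    intro y hy
    obtain ⟨U, hU, hUf⟩ := hoff (eV.symm y) (hne y hy)
    refine ⟨eV.symm ⁻¹' U, eV.symm.continuous.continuousAt.preimage_mem_nhds hU, ?_⟩
    rw [htrans, show eV ⁻¹' (eV.symm ⁻¹' U) = U from by ext v; simp]
    exact hUf
  have key := forall_exists_nhds_setLIntegral_lt_top_of_homogeneous_pi (μ.map e) a k hk ha g c hhom' hc hoff'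
  intro y
  obtain ⟨U', hU', hU'f⟩ := key (eV y)
  refine ⟨eV ⁻¹' U', eV.continuous.continuousAt.preimage_mem_nhds hU', ?_⟩
  rw [← htrans]
  exact hU'f

end Trivialised

/-! ## §5 Local sockets (ED. 2, appended; §1–§4 byte-identical): the box lemmas made public, and the `W₀`-LOCAL forms of §2–§3
for consumers whose homogeneity ∕ finiteness are known only NEAR the vertex (ROAD «HC-D» D5(iii): the Slodowy slice). -/

section LocalSockets

variable {V : Type*} [TopologicalSpace V] [MeasurableSpace V] [BorelSpace V]

/-- **Vertex engine, Jacobian form, `W₀`-local.**  As `forall_exists_nhds_setLIntegral_lt_top_of_measure_image_le`, but the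
Jacobian bound `μ (T '' s) ≤ d · μ s`, the sub-homogeneity `f (T v) ≤ c · f v` and the finiteness near `y ≠ x₀` are only asked
INSIDE the compact `T`-stable neighbourhood `W₀` of the vertex; conclusion `∫⁻ x in W₀, f x ∂μ < ∞`.
[cite: Tate1950, §2.4 (local zeta integral, shell by shell; abstract form of the argument)] -/
theorem setLIntegral_lt_top_of_measure_image_le (μ : Measure V) (T : V ≃ₜ V) (x₀ : V) (h0 : μ {x₀} = 0) (W₀ : Set V)
    (hW₀c : IsCompact W₀) (hW₀m : MeasurableSet W₀) (hT : T '' W₀ ⊆ W₀) (hx₀ : T '' W₀ ∈ 𝓝 x₀)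
    (hcore : (⋂ k, T^[k] '' W₀) ⊆ {x₀}) (d : ℝ≥0∞) (hJ : ∀ s ⊆ W₀, MeasurableSet s → μ (T '' s) ≤ d * μ s)
    (f : V → ℝ≥0∞) (c : ℝ≥0∞) (hhom : ∀ v ∈ W₀, v ≠ x₀ → f (T v) ≤ c * f v) (hc : d * c < 1)
    (hoff : ∀ y ∈ W₀, y ≠ x₀ → ∃ U ∈ 𝓝 y, ∫⁻ x in U, f x ∂μ < ∞) :
    ∫⁻ x in W₀, f x ∂μ < ∞ := by
  let Te : V ≃ᵐ V := T.toMeasurableEquiv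
  have hTe : ∀ v, Te v = T v := fun _ => rfl
  have himg : ∀ s : Set V, T '' s = Te.symm ⁻¹' s := fun s => by
    ext y
    simp only [mem_preimage, mem_image]
    constructor
    · rintro ⟨x, hx, rfl⟩; rw [← hTe, MeasurableEquiv.symm_apply_apply]; exact hx
    · intro hy; exact ⟨Te.symm y, hy, by rw [← hTe, MeasurableEquiv.apply_symm_apply]⟩
  have hcontract : ∀ A ⊆ W₀, MeasurableSet A → ∫⁻ x in T '' A, f x ∂μ ≤ (d * c) * ∫⁻ x in A, f x ∂μ := by
    intro A hAW hA
    -- `(T⁻¹_* μ)|_A ≤ d • μ|_A`, from the Jacobian bound on measurable subsets of `W₀`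
    have hmapA : (μ.map Te.symm).restrict A ≤ d • μ.restrict A := Measure.le_iff.2 fun s hs => by
      rw [Measure.restrict_apply hs, MeasurableEquiv.map_apply, Measure.smul_apply, Measure.restrict_apply hs, smul_eq_mul,
        ← himg]
      exact hJ _ (inter_subset_right.trans hAW) (hs.inter hA)
    have step : ∫⁻ x in T '' A, f x ∂μ ≤ d * ∫⁻ x in A, f (T x) ∂μ := by
      calc ∫⁻ x in T '' A, f x ∂μ = ∫⁻ x in Te.symm ⁻¹' A, f (Te (Te.symm x)) ∂μ := by
            rw [himg]; simp only [MeasurableEquiv.apply_symm_apply]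
        _ = ∫⁻ y in A, f (Te y) ∂(μ.map Te.symm) := by rw [MeasurableEquiv.restrict_map, lintegral_map_equiv]
        _ ≤ ∫⁻ y, f (Te y) ∂(d • μ.restrict A) := lintegral_mono' hmapA le_rfl
        _ = d * ∫⁻ x in A, f (T x) ∂μ := by rw [lintegral_smul_measure, smul_eq_mul]; rfl
    by_cases hct : c = ∞
    · have hd : d = 0 := by
        by_contra hd
        rw [hct, ENNReal.mul_top hd] at hc
        exact not_top_lt hc
      rw [hd, zero_mul] at step
      exact (nonpos_iff_eq_zero.1 step).le.trans bot_le
    have hae : (fun x => f (T x)) ≤ᵐ[μ.restrict A] fun x => c * f x := by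
      have hA0 : (μ.restrict A) {x₀} = 0 :=
        le_antisymm ((Measure.le_iff'.1 Measure.restrict_le_self _).trans h0.le) bot_le
      filter_upwards [compl_mem_ae_iff.2 hA0, ae_restrict_mem hA] with x hx hxA
      exact hhom x (hAW hxA) hx
    calc ∫⁻ x in T '' A, f x ∂μ ≤ d * ∫⁻ x in A, f (T x) ∂μ := step
      _ ≤ d * ∫⁻ x in A, c * f x ∂μ := by gcongr d * ?_; exact lintegral_mono_ae hae
      _ = (d * c) * ∫⁻ x in A, f x ∂μ := by rw [lintegral_const_mul' c _ hct, mul_assoc]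
  have hcore' : ∫⁻ x in ⋂ k, (T : V → V)^[k] '' W₀, f x ∂μ = 0 :=
    setLIntegral_measure_zero _ _ (measure_mono_null hcore h0)
  have hTm : ∀ A : Set V, MeasurableSet A → MeasurableSet (T '' A) := fun A hA => by
    rw [himg]; exact Te.symm.measurable hA
  exact setLIntegral_lt_top_of_contraction μ f T hTm W₀ hW₀c hW₀m hT x₀ hx₀ (d * c) hc hcontract hcore' hoff

variable {F : Type*} [Field F] [ValuativeRel F] [TopologicalSpace F] [IsNonarchimedeanLocalField F] {ι : Type*}

/-- **The dilation maps boxes to boxes** (public form of §3's lemma): `D (∏ᵢ 𝔭^{nᵢ}) = ∏ᵢ 𝔭^{nᵢ + kᵢ}` for the dilation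
`D x = (aᵢ xᵢ)ᵢ` with `‖aᵢ‖_F = (q⁻¹)^{kᵢ}`. [cite: Tate1950, §2.4 (shells `𝔭^m ∖ 𝔭^{m+1}` and their dilates)] -/
theorem image_dilation_pi_eq (a : ι → F) (k : ι → ℕ) (ha : ∀ i, normAbs F (a i) = ((residueFieldCard F : ℝ≥0)⁻¹) ^ k i)
    (D : (ι → F) ≃L[F] (ι → F)) (hD : ∀ x i, D x i = a i * x i) (n : ι → ℤ) :
    D '' Set.pi univ (fun i => primePowBall F (n i)) = Set.pi univ (fun i => primePowBall F (n i + k i)) :=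
  image_dilation_pi a k ha D hD n

/-- **Iterated dilation of a box**: `D^[j] (∏ᵢ 𝔭^{nᵢ}) = ∏ᵢ 𝔭^{nᵢ + j kᵢ}`. [cite: Tate1950, §2.4 (shells and their dilates)] -/
theorem image_iterate_dilation_pi_eq (a : ι → F) (k : ι → ℕ)
    (ha : ∀ i, normAbs F (a i) = ((residueFieldCard F : ℝ≥0)⁻¹) ^ k i)
    (D : (ι → F) ≃L[F] (ι → F)) (hD : ∀ x i, D x i = a i * x i) (n : ι → ℤ) (j : ℕ) :
    (D : (ι → F) → ι → F)^[j] '' Set.pi univ (fun i => primePowBall F (n i)) =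
      Set.pi univ (fun i => primePowBall F (n i + j * k i)) :=
  image_iterate_dilation_pi a k ha D hD n j

/-- **The core of the contraction of ANY box is the vertex**: `⋂ⱼ D^[j] (∏ᵢ 𝔭^{nᵢ}) ⊆ {0}` when all `kᵢ ≥ 1`.
[cite: Tate1950, §2.4 (shells and their dilates)] -/
theorem iInter_image_iterate_dilation_pi_subset (a : ι → F) (k : ι → ℕ) (hk : ∀ i, 1 ≤ k i)
    (ha : ∀ i, normAbs F (a i) = ((residueFieldCard F : ℝ≥0)⁻¹) ^ k i)
    (D : (ι → F) ≃L[F] (ι → F)) (hD : ∀ x i, D x i = a i * x i) (n : ι → ℤ) :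
    (⋂ j : ℕ, (D : (ι → F) → ι → F)^[j] '' Set.pi univ (fun i => primePowBall F (n i))) ⊆ {0} := by
  intro x hx
  rw [mem_singleton_iff]; funext i; rw [Pi.zero_apply]
  by_contra hxi
  set r : ℝ≥0 := (residueFieldCard F : ℝ≥0)⁻¹ with hr
  have hr0 : 0 < r := inv_residueFieldCard_pos
  have hpos : 0 < normAbs F (x i) := pos_iff_ne_zero.2 fun h => hxi ((map_eq_zero (normAbs F)).1 h)
  have hrk : r ^ k i < 1 := pow_lt_one₀ hr0.le inv_residueFieldCard_lt_one (Nat.one_le_iff_ne_zero.1 (hk i))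
  obtain ⟨j, hj⟩ := exists_pow_lt_of_lt_one (div_pos hpos (zpow_pos hr0 (n i))) hrk
  have hxj : x ∈ (D : (ι → F) → ι → F)^[j] '' Set.pi univ (fun i => primePowBall F (n i)) := mem_iInter.1 hx j
  rw [image_iterate_dilation_pi a k ha D hD n j, mem_univ_pi] at hxj
  have h1 := hxj i
  rw [mem_primePowBall_iff] at h1
  have h2 : r ^ (n i + (j : ℤ) * (k i : ℤ)) = r ^ n i * (r ^ k i) ^ j := by
    rw [zpow_add₀ hr0.ne', mul_comm (j : ℤ), zpow_mul, zpow_natCast, zpow_natCast]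
  rw [h2] at h1
  rw [lt_div_iff₀ (zpow_pos hr0 (n i)), mul_comm] at hj
  exact (lt_irrefl _) (h1.trans_lt hj)

variable [MeasurableSpace F] [BorelSpace F] [Fintype ι] [Nonempty ι]

/-- **Vertex engine on a box of `ι → F`, local form.**  As `forall_exists_nhds_setLIntegral_lt_top_of_homogeneous_pi`, but on
the box `B = ∏ᵢ 𝔭^{nᵢ}` of ANY radii `n`: sub-homogeneity `f (D x) ≤ c · f x` and finiteness near `y ≠ 0` are asked only for
points of `B`; conclusion `∫⁻ x in B, f x ∂μ < ∞` (so `f` is integrable near the vertex as soon as it is so near every other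
point CLOSE to the vertex).  [cite: Tate1950, §2.4 (local zeta integral, shell by shell; weighted-homogeneous form)] -/
theorem setLIntegral_pi_primePowBall_lt_top_of_homogeneous (μ : Measure (ι → F)) [μ.IsAddHaarMeasure]
    (a : ι → F) (k : ι → ℕ) (hk : ∀ i, 1 ≤ k i) (ha : ∀ i, normAbs F (a i) = ((residueFieldCard F : ℝ≥0)⁻¹) ^ k i)
    (n : ι → ℤ) (f : (ι → F) → ℝ≥0∞) (c : ℝ≥0∞)
    (hhom : ∀ x ∈ Set.pi univ (fun i => primePowBall F (n i)), x ≠ 0 → f (fun i => a i * x i) ≤ c * f x)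
    (hc : c < (residueFieldCard F : ℝ≥0∞) ^ (∑ i, k i))
    (hoff : ∀ y ∈ Set.pi univ (fun i => primePowBall F (n i)), y ≠ 0 → ∃ U ∈ 𝓝 y, ∫⁻ x in U, f x ∂μ < ∞) :
    ∫⁻ x in Set.pi univ (fun i => primePowBall F (n i)), f x ∂μ < ∞ := by
  have ha0 := ne_zero_of_normAbs_eq a k ha
  haveI := secondCountableTopology_localField F
  obtain ⟨D, hD⟩ := exists_dilation_continuousLinearEquiv (F := F) a ha0
  have hDfun : ∀ x, D x = fun i => a i * x i := fun x => funext (hD x)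
  set δ : ℝ≥0∞ := ((((residueFieldCard F : ℝ≥0)⁻¹) ^ (∑ i, k i) : ℝ≥0) : ℝ≥0∞) with hδ
  have hq0 : (residueFieldCard F : ℝ≥0∞) ≠ 0 := by exact_mod_cast (residueFieldCard_ne_zero F)
  have hqS0 : (residueFieldCard F : ℝ≥0∞) ^ (∑ i, k i) ≠ 0 := pow_ne_zero _ hq0
  have hqStop : (residueFieldCard F : ℝ≥0∞) ^ (∑ i, k i) ≠ ∞ := ENNReal.pow_ne_top (ENNReal.natCast_ne_top _)
  have hδ' : δ = ((residueFieldCard F : ℝ≥0∞) ^ (∑ i, k i))⁻¹ := by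
    rw [hδ, ENNReal.coe_pow, ENNReal.coe_inv (by exact_mod_cast (residueFieldCard_ne_zero F)), ENNReal.coe_natCast,
      ENNReal.inv_pow]
  have hθ : δ * c < 1 := by
    rw [hδ']
    calc ((residueFieldCard F : ℝ≥0∞) ^ ∑ i, k i)⁻¹ * c
        < ((residueFieldCard F : ℝ≥0∞) ^ ∑ i, k i)⁻¹ * (residueFieldCard F : ℝ≥0∞) ^ ∑ i, k i :=
          ENNReal.mul_lt_mul_right (ENNReal.inv_ne_zero.2 hqStop) (ENNReal.inv_ne_top.2 hqS0) hc
      _ = 1 := ENNReal.inv_mul_cancel hqS0 hqStop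
  -- the box and its properties
  set W₀ : Set (ι → F) := Set.pi univ (fun i => primePowBall F (n i)) with hW₀
  have hW₀c : IsCompact W₀ := isCompact_univ_pi fun i => isCompact_primePowBall (n i)
  have hW₀o : IsOpen W₀ := isOpen_set_pi finite_univ fun i _ => isOpen_primePowBall (n i)
  have h0W₀ : (0 : ι → F) ∈ W₀ := fun i _ => zero_mem_primePowBall (n i)
  have hDW₀ : D '' W₀ = Set.pi univ (fun i => primePowBall F (n i + k i)) := image_dilation_pi a k ha D hD n
  have hT : D '' W₀ ⊆ W₀ := by
    rw [hDW₀]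
    exact pi_mono fun i _ => primePowBall_antitone (by omega)
  have hx₀ : D '' W₀ ∈ 𝓝 (0 : ι → F) := by
    rw [hDW₀]
    exact (isOpen_set_pi finite_univ fun _ _ => isOpen_primePowBall _).mem_nhds fun i _ => zero_mem_primePowBall _
  have hδ1 : δ < 1 := by
    rw [hδ']
    refine ENNReal.inv_lt_one.2 (one_lt_pow₀ ?_ ?_)
    · exact_mod_cast one_lt_residueFieldCard F
    · exact (Finset.sum_pos (fun i _ => hk i) Finset.univ_nonempty).ne'
  have hμ0 : μ {0} = 0 := by
    have h := addHaar_image_dilation μ a k ha D hD {0}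
    rw [image_singleton, map_zero] at h
    have hfin : μ {0} < ∞ := (measure_mono (singleton_subset_iff.2 h0W₀)).trans_lt hW₀c.measure_lt_top
    by_contra hne
    have h2 : δ * μ {0} < 1 * μ {0} := ENNReal.mul_lt_mul_left hne hfin.ne hδ1
    rw [one_mul, ← h] at h2
    exact lt_irrefl _ h2
  refine setLIntegral_lt_top_of_measure_image_le μ D.toHomeomorph 0 hμ0 W₀ hW₀c hW₀o.measurableSet hT hx₀
    (iInter_image_iterate_dilation_pi_subset a k hk ha D hD n) δ (fun s _ _ => (addHaar_image_dilation μ a k ha D hD s).le)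
    f c (fun x hxW hx => ?_) hθ hoff
  change f (D x) ≤ c * f x
  rw [hDfun]; exact hhom x hxW hx

end LocalSockets

end Literature.MeasureTheory.Integral

end
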